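import Summits.BirchSwinnertonDyer.BirchSwinnertonDyer.Theses.EisensteinPrimes
import Summits.BirchSwinnertonDyer.BirchSwinnertonDyer.Theorems.EisensteinPrimesMazurMCOnCellBTwistbackLowerHalf
import Summits.BirchSwinnertonDyer.BirchSwinnertonDyer.Theorems.SchneiderFreeAdditiveX3JointUpperManin
import Summits.BirchSwinnertonDyer.Rank1Residual.X2.TwistParityStability
import Summits.BirchSwinnertonDyer.Rank1Residual.X2.RankOne
import Literature.NumberTheory.EllipticCurves.BSDSelmerPConverseYanZhuProofs
import Literature.NumberTheory.EllipticCurves.HeegnerPointsRationalityProofs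
import Literature.NumberTheory.EllipticCurves.GrossZagierRankOneProofs
import Literature.NumberTheory.EllipticCurves.HeegnerHypothesisKroneckerProofs
import Literature.NumberTheory.EllipticCurves.TateCurve.NumberFieldUniformization
import Literature.NumberTheory.EllipticCurves.TateCurve.NumberFieldUniformizationTwisted
import HarnessLib

/-!
# Crux `MazurMCOnCellB` (stmt-BirchSwinnertonDyer-19033) — the KNOT: crux 3 gives back the Euler-system
# half of `BSD(p)` on X2c ∩ `GVPar`, granted co-STEP L over a Heegner field of the rank-one curve

LEAD bsd-line-x2-p1 g7 (2026-08-28); companion of p625263/p626318 (crux 3 ⇐ STEP L in the rank-zero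
orientation + the UPPER half on X2c ∩ `GVPar`) and p627870 (the twist-unit lever / transfer). Those
files reduce row A10 to the Euler-system (Kato–Kolyvagin) half of Miller's `BSD(E,p)` on the GV-type
rank-one class X2c ∩ `GVPar`, modulo STEP L. THIS FILE is the CONVERSE bookkeeping: granted crux 3
ITSELF and co-STEP L over `K` (the Kolyvagin direction `ord_p #Ш(E/K) + 2·ord_p ∏c(E) + 2·v_p(c) ≤
2·ord_p [E(K):ℤP]`, `SchneiderFree.IndexUpperBoundLeAt`) at every X2c ∩ `GVPar` Heegner datum, the
upper half holds at every X2c ∩ `GVPar` pair. Mechanism: for `(E, p)` in X2c ∩ `GVPar` (`r_an = 1`,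
`w(E) = −1`), Hoffstein–Luo (conjunct 7 of `PublishedInputs`) gives an admissible `K` (Heegner for `N`,
`p` and `2` split, `d_K ≡ 1 (8)`, `|d_K| > 4`) with `L(E^{(d_K)},1) ≠ 0`; the twist `E″ = E^K` is an
X2 pair (`X2.classX2_twist`) of the OTHER parity type (`X2.gvPar_twist_iff_not_gvPar_of_neg_of_mult`,
Tate uniformisation DISCHARGED) and analytic rank `0` — an X2b pair — where crux 3 gives Mazur's main
conjecture, hence `BSD(E″,p)` (`X2.bsdp_of_mazurMainConjectureAt_of_analyticRank_eq_zero`) and its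
LOWER half; co-STEP L at `(E, K, P_K)` gives the JOINT upper half over `(E, E″)`
(`SchneiderFree.Upper.jointUpperBoundAt_of_coStepL_manin`, class-agnostic, `p ∣ N`); joint upper + the
partner's lower half = the upper half at `E` (`missingUpperBoundAt_of_jointUpper_of_lower`).

THE KNOT (planning fact, kernel in both directions): modulo STEP L over `K` in the rank-ZERO
orientation (p626318 §3) and co-STEP L over `K` in the rank-ONE orientation on X2c ∩ `GVPar` (this
file) — the two halves of the route's item `HeegnerIndexIdentityKRankOne` (-27489), in two orientations —
and `PublishedInputs` (+ BFH / Mazur 4.1 / `hHP` / Edixhoven on the p626318 side):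
  `MazurMCOnCellB`  ⟺  [∀ X2c ∩ `GVPar` pairs, `Typed.MissingUpperBoundAt`].
So rows A10 and B11's shared irreducible content is the Euler-system half of `BSD(p)` at the GV-type
rank-one multiplicative Eisenstein pairs; it is cut by a cyclotomic input (Schneider = item -27490 +
Disegni + the split exceptional leading term), by the μ-road (mudescent), by the twist-unit lever
(p627870), and by nothing `K`-level alone.

HONEST FRAMING: nothing here proves a main conjecture or BSD for any curve; crux 3, co-STEP L at `p ‖ N`
for reducible `E[p]` (Kolyvagin at an Eisenstein prime: Lawson–Wuthrich 2016 Thm. 14's reducible case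
is CONTESTED by Matar–Nekovář and Tamagawa-free; CGLS §3 / Keller–Yin are good-`p` / PREPRINT) and every
`PublishedInputs` conjunct are hypotheses BY NAME. 0 cells / 0 labels / 0 stubs move; skeleton
`mudescent` v4 untouched. Imports the route file directly + route-independent modules (the SchneiderFree
sockets chain imports no `Theses` file).

References: [JetchevSkinnerWan2017] §7.4.1; [GrossZagier1986] I.(6.3), I.(7.3), V.§2; [HoffsteinLuo1997]
Theorem (§1); [MurtyMurty1997] Ch. 6 §1; [LawsonWuthrich2016] Thm. 14; [Wuthrich2014] Thm. 16;
[SteinWuthrich2013] Thm. 6.1; [GreenbergVatsal2000] Thm. (1.3); [Miller2011LMS] Def. 1.1.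
-/

set_option autoImplicit false

-- `Summit.BirchSwinnertonDyer.BirchSwinnertonDyer.…`: the summit and its single sub-problem share a name.
set_option linter.dupNamespace false

noncomputable section

open scoped Classical

open WeierstrassCurve NumberField
  Literature.NumberTheory.EllipticCurves
  Literature.NumberTheory.EllipticCurves.ModularForms
  Literature.NumberTheory.EllipticCurves.Rank1Residual
  Literature.NumberTheory.EllipticCurves.Rank1Residual.Typed
  Literature.NumberTheory.EllipticCurves.Wuthrich2014
  Literature.NumberTheory.EllipticCurves.SteinWuthrich2013
  Summit.BirchSwinnertonDyer.Rank1Residual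
  Summit.BirchSwinnertonDyer.BirchSwinnertonDyer.Theses
  Summit.BirchSwinnertonDyer.BirchSwinnertonDyer.Theorems.SchneiderFree
  Summit.BirchSwinnertonDyer.BirchSwinnertonDyer.Theorems.SchneiderFree.Upper

namespace Summit.BirchSwinnertonDyer.BirchSwinnertonDyer.Theorems.EisensteinPrimesMazurMCOnCellBTwistbackKnot

/-- **THE KNOT, → direction: crux 3 + co-STEP L on X2c ∩ `GVPar` ⟹ the UPPER half of `BSD(p)` on
X2c ∩ `GVPar`.** Hypotheses: `PublishedInputs` (Hoffstein–Luo, modularity, Gross–Zagier I.7.3 and over `K`,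
Kolyvagin, GZK, Stein–Wuthrich, Greenberg–Stevens are the conjuncts used); crux 3 `MazurMCOnCellB` BY
NAME; `hco` = co-STEP L over `K` at every X2c ∩ `GVPar` Heegner datum with a non-torsion Heegner point
(`IndexUpperBoundLeAt W p K P (v_p c(Dt))`: `ord_p #Ш(E/K) + 2·ord_p ∏c(E) + 2·v_p(c) ≤ 2·ord_p [E(K):ℤP]`,
the Kolyvagin direction; admissible `K`: `d_K` odd `< -4`, Heegner for `N`, `L(E^{(d_K)},1) ≠ 0`).
Conclusion: `Typed.MissingUpperBoundAt` at every X2c ∩ `GVPar` pair. Proof: Hoffstein–Luo field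
(`exists_heegnerField_split_twist_ne_zero_discr_emod_eight_of_hoffsteinLuo`, `w(E) = −1`), parametrisation
datum (`hpar`), Heegner datum and point (Kronecker lemmas, `heegnerPointComplex_mem_range_map_holds`),
non-torsion of `P` from `L'(E/K,1) = L'(E,1)·L(E^K,1) ≠ 0` (Gross–Zagier), a globally minimal model `W″`
of `E^K`: an X2b pair (`X2.classX2_twist`, `X2.gvPar_twist_iff_not_gvPar_of_neg_of_mult`, rank `0`), so
crux 3 ⟹ MC ⟹ `BSDp W″ p` ⟹ its lower half; `jointUpperBoundAt_of_coStepL_manin` ⟹ joint upper over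
`(W, W″)`; `missingUpperBoundAt_of_jointUpper_of_lower`. [cite: HoffsteinLuo1997, Theorem (§1, pp. 435–436)]
[cite: GrossZagier1986, Thm. I.(6.3) and (7.3)] [cite: JetchevSkinnerWan2017, §7.4.1 (arXiv:1512.06894 p. 30)]
[cite: LawsonWuthrich2016, Thm. 14 (what hco would need at a reducible prime; hypothesis)]
[cite: SteinWuthrich2013, Thm. 6.1 (p. 20)] [cite: Miller2011LMS, Def. 1.1] -/
theorem upper_cellC_gvPar_of_mazurMCOnCellB_of_coStepL (hP : EisensteinPrimes.PublishedInputs)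
    (hMC : EisensteinPrimes.MazurMCOnCellB)
    (hco : ∀ (W : WeierstrassCurve ℚ) [W.IsElliptic] [W.IsGloballyMinimal] (p : ℕ) [Fact p.Prime]
        (N : ℕ) [NeZero N] (K : Type) [Field K] [NumberField K]
        (Dt : ModularParametrizationData W N) (H : HeegnerDatum N (NumberField.discr K)) (ι : K →+* ℂ)
        (P : (W.baseChange K).toAffine.Point),
      X2.CellC W p → GVPar W p → W.conductorNorm ℤ = N → IsImaginaryQuadratic K →
      Odd (NumberField.discr K) → NumberField.discr K < -4 → SatisfiesHeegnerHypothesis N K →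
      (W.quadraticTwist (NumberField.discr K : ℚ)).entireLFunction 1 ≠ 0 →
      WeierstrassCurve.Affine.Point.map ι.toRatAlgHom P = heegnerPointComplex Dt H →
      ¬ IsOfFinAddOrder P → IndexUpperBoundLeAt W p K P (padicValNat p Dt.c.natAbs)) :
    ∀ (W : WeierstrassCurve ℚ) [W.IsElliptic] [W.IsGloballyMinimal] (p : ℕ) [Fact p.Prime],
      X2.CellC W p → GVPar W p → MissingUpperBoundAt W p := by
  have hpar := hP.2.2.2.2.1
  have hnf := hP.2.2.2.2.2.1
  have hHL := hP.2.2.2.2.2.2.1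
  have hGZ73 := hP.2.2.2.2.2.2.2.1
  have hGZ := hP.2.2.2.2.2.2.2.2.1
  have hKo := hP.2.2.2.2.2.2.2.2.2.1
  have hGZK := hP.2.2.2.2.2.2.2.2.2.2.1
  have hJs := hP.2.2.2.2.2.2.2.2.2.2.2.2.2.2.2.1
  have hJn := hP.2.2.2.2.2.2.2.2.2.2.2.2.2.2.2.2.1
  have hHs := hP.2.2.2.2.2.2.2.2.2.2.2.2.2.2.2.2.2.1
  have hHn := hP.2.2.2.2.2.2.2.2.2.2.2.2.2.2.2.2.2.2.1
  have hGS := hP.2.2.2.2.2.2.2.2.2.2.2.2.2.2.2.2.2.2.2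
  have hE : WeierstrassCurve.hasEntireLFunction_rat :=
    WeierstrassCurve.hasEntireLFunction_rat_of_exists_isNewformOf hnf
  intro W _ _ p _ hc hgv
  have hpP : p.Prime := Fact.out
  have hr1 : W.analyticRank = 1 := hc.1
  have hX : ClassX2 W p := hc.2
  have hp2 : p ≠ 2 := hX.1
  have hred : ¬ W.HasIrreducibleModPGaloisRep p := hX.2.1
  have hmult : W.HasMultiplicativeReductionAtPrime p := hX.2.2
  ---------------------------------------------------------------- `w(E) = -1`, the Hoffstein–Luo field
  have hw : W.rootNumber = -1 := by
    rcases rootNumber_eq_one_or_eq_neg_one W with h | h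
    · exact absurd ((even_analyticRank_iff_rootNumber_eq_one_of_exists_isNewformOf W hnf).mpr h)
        (by rw [hr1]; exact Nat.not_even_one)
    · exact h
  obtain ⟨K, _, _, hK, hB, hHN, hHp, hd8, hL⟩ :=
    exists_heegnerField_split_twist_ne_zero_discr_emod_eight_of_hoffsteinLuo hnf hHL W hw hpP 4
  have hodd : Odd (NumberField.discr K) := Int.odd_iff.mpr (by omega)
  have hneg : NumberField.discr K < 0 := IsImaginaryQuadratic.discr_neg hK
  have hlt : NumberField.discr K < -4 := by
    have h4 : (4 : ℤ) < ((NumberField.discr K).natAbs : ℤ) := by exact_mod_cast hB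
    omega
  have hwK : ¬ p ∣ Units.torsionOrder K := X2.not_dvd_unitsTorsionOrder_of_discr_lt hK hlt hpP hp2
  have hpd : ¬ (p : ℤ) ∣ NumberField.discr K := not_dvd_discr_of_split hK hpP hp2 hHp
  have hd0 : (NumberField.discr K : ℚ) ≠ 0 := by exact_mod_cast NumberField.discr_ne_zero K
  haveI := W.isElliptic_quadraticTwist hd0
  ---------------------------------------------------------------- parametrisation, Heegner datum, Heegner point
  haveI : NeZero (W.conductorNorm ℤ) := ⟨(W.conductorNorm_pos_holds).ne'⟩
  obtain ⟨Dt⟩ := hpar W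
  obtain ⟨β, hβ⟩ := exists_dvd_sq_sub_discr_holds (W.conductorNorm ℤ) K hK hHN
  obtain ⟨H, -⟩ := nonempty_heegnerDatum_holds (W.conductorNorm ℤ) K hK hβ
  obtain ⟨ι⟩ : Nonempty (K →+* ℂ) := inferInstance
  obtain ⟨P, hPt⟩ := heegnerPointComplex_mem_range_map_holds (W.conductorNorm ℤ) W K hK hHN Dt H ι
  -- `P` is non-torsion: `L'(E/K,1) = L'(E,1) · L(E^K,1) ≠ 0`
  have h0 : W.entireLFunction 1 = 0 := entireLFunction_one_eq_zero_of_analyticRank_eq_one hr1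
  obtain ⟨-, hderiv⟩ := leadingLCoeff_eq_deriv_of_analyticRank_eq_one hr1
  have hLK : LDerivEK W K ≠ 0 := by
    rw [lDerivEK_eq_deriv_mul_of_entireLFunction_one_eq_zero hE W K h0]
    exact mul_ne_zero hderiv hL
  have hPH : IsHeegnerPoint (W.conductorNorm ℤ) W K P := ⟨Dt, H, ι, hPt⟩
  have hPinf : ¬ IsOfFinAddOrder P :=
    (lDerivEK_ne_zero_iff_not_isOfFinAddOrder W (W.conductorNorm ℤ) K (hGZ _ W K) hK hHN hPH).mp hLK
  ---------------------------------------------------------------- the twist: an X2b pair; crux 3 there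
  obtain ⟨W'', _, _, C, hC⟩ := exists_isGloballyMinimal_smul_eq_quadraticTwist W hd0
  have hr0 : W''.analyticRank = 0 := by
    have h := congrArg WeierstrassCurve.analyticRank hC
    rw [analyticRank_smul] at h
    exact h.trans (analyticRank_eq_zero_of_entireLFunction_one_ne_zero _ hL)
  have hX'' : ClassX2 W'' p := X2.classX2_twist W p hX K hK hHp W'' ⟨C, hC⟩
  have hngv : ¬ GVPar W'' p := fun h ↦
    ((X2.gvPar_twist_iff_not_gvPar_of_neg_of_mult TateCurve.Silverman1994_thmV53_tateUniformisation_holds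
      TateCurve.Silverman1994_thmV53_corV54_tateUniformisation_holds hp2 hmult hred hneg hpd C
      (by simpa using hC)).mp h) hgv
  have hcB : X2.CellB W'' p := ⟨hr0, hX'', hngv⟩
  have hMC'' : X2.MazurMainConjectureAt W'' p := by
    unfold EisensteinPrimes.MazurMCOnCellB at hMC
    exact hMC W'' p hcB
  have hbsd'' : BSDp W'' p :=
    X2.bsdp_of_mazurMainConjectureAt_of_analyticRank_eq_zero hJs hJn hHs hHn hGZK hE hpar W'' p (hGS W'' p)
      hp2 hX''.2.2 hr0 hMC''
  haveI : Finite W''.sha := (hGZK W'' (by rw [hr0]; exact zero_le_one)).2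
  have hL'' : MissingLowerBoundAt W'' p :=
    (lower_and_upper_of_missingPPartAt W'' p (missingPPartAt_of_bsdp W'' p hbsd'')).1
  ---------------------------------------------------------------- co-STEP L ⟹ joint upper; descend
  have hI : IndexUpperBoundLeAt W p K P (padicValNat p Dt.c.natAbs) :=
    hco W p (W.conductorNorm ℤ) K Dt H ι P hc hgv rfl hK hodd hlt hHN hL hPt hPinf
  have hN0 : W.conductorNorm ℤ ≠ 0 := (W.conductorNorm_pos_holds).ne'
  have hfac := W.factorization_conductorNorm_eq_one_of_hasMultiplicativeReductionAtPrime p hmult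
  have hpN : p ∣ W.conductorNorm ℤ := (hpP.dvd_iff_one_le_factorization hN0).mpr hfac.ge
  have hJU : JointUpperBoundAt W W'' p :=
    jointUpperBoundAt_of_coStepL_manin hGZ hKo hGZK hE hGZ73 W p (W.conductorNorm ℤ) K Dt H ι P W'' hr1
      rfl hpN hK hodd hwK hHN hL hPt ⟨C⁻¹, by rw [← hC, inv_smul_smul]⟩ hp2 hI
  exact missingUpperBoundAt_of_jointUpper_of_lower hJU hL''

end Summit.BirchSwinnertonDyer.BirchSwinnertonDyer.Theorems.EisensteinPrimesMazurMCOnCellBTwistbackKnot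

end
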